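import Summits.Parity.GeneralizedHardyLittlewood.Theorems.ChenParityOracleBLAPHostParityFromBrickTypeIIGoodWide
import Summits.Parity.GeneralizedHardyLittlewood.Theorems.ChenParityOracleBLAPHostParityFromBrickTypeIIBad
import Summits.Parity.GeneralizedHardyLittlewood.Theorems.ChenParityOracleBLAPHostParityFromBrickTypeIIPairs
import HarnessLib

/-!
# Route `ChenParityOracleBLAP` — crux S1 = `HostParityFromBrick` (stmt-Parity-20045): Type-II pieces — the hyperbolic Type-II bound

Support file for the prime half `K1 → K2 → HP1` of S1 (Type-II dispatch of Vaughan's identity).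
For K-class coefficients `α, β`, a dyadic `m`-range `(M, 2M]` inside the K-window
(`ρ(x^{1/3−δ}+1) ≤ M`, `2M ≤ x^{2/3}`; classes with `m > x^{1/2}` are handled with the roles of `m, n` swapped), a height `y ≤ x` and a lower cut `V₀`, the level-`x^{1/2−ε}`
congruence sums of the hyperbolic bilinear form
`T_d = ∑_{M<m≤2M} ∑_{V₀<n≤y/m} α(m)β(n)[d ∣ mn+2]λ(mn+2)` satisfy (`typeII_hyperbolic_static`)
`∑_{d ≤ x^{1/2−ε}} |T_d| ≤ #classes · (1+(1+log x)²) x/(log x)^A + √(4(ρ−1)y + M + 4ρ²x^{1−δ}) · √(C_τ (y+2) (log(y+2))^{20})`,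
given the K1/K2 bodies at `(δ, A)` for this `x`: good `ρ`-adic classes through the brick
(`good_class_level_sum_le_wide`), bad pairs trivially (`card_badPairs_le`, `sum_level_pairs_trivial_le`).

References: H. Iwaniec, E. Kowalski, *Analytic Number Theory* (2004), §13.4, §17.3
[IwaniecKowalski2004].
-/

namespace Summit.Parity.GeneralizedHardyLittlewood.Theorems

open Finset Real
open scoped ArithmeticFunction.sigma
open ArithmeticFunction (liouville sigma)

/-- A class as a set of pairs: the iterated class sum equals the sum over the pairs of the region
with the given indices. -/
theorem class_sum_eq_sum_pairs {ρ : ℝ} (M y V₀ i c : ℕ) (F : ℕ → ℕ → ℝ) :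
    ∑ m ∈ (Ioc M (2 * M)).filter (fun m : ℕ => ⌊Real.log (m : ℝ) / Real.log ρ⌋₊ = i),
        ∑ n ∈ (Ioc V₀ (y / m)).filter (fun n : ℕ => ⌊Real.log (n : ℝ) / Real.log ρ⌋₊ = c), F m n =
      ∑ p ∈ (((Ioc M (2 * M)) ×ˢ (Icc 1 y)).filter
          (fun p : ℕ × ℕ => p.2 ∈ Ioc V₀ (y / p.1))).filter
          (fun p : ℕ × ℕ => ⌊Real.log (p.1 : ℝ) / Real.log ρ⌋₊ = i ∧
            ⌊Real.log (p.2 : ℝ) / Real.log ρ⌋₊ = c), F p.1 p.2 := by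
  classical
  have h := sum_region_eq_sum_pairs M y V₀ (fun m n =>
    if ⌊Real.log (m : ℝ) / Real.log ρ⌋₊ = i ∧ ⌊Real.log (n : ℝ) / Real.log ρ⌋₊ = c then F m n else 0)
  conv_rhs => rw [Finset.sum_filter]
  rw [← h, Finset.sum_filter]
  refine Finset.sum_congr rfl fun m _ => ?_
  by_cases hm : ⌊Real.log (m : ℝ) / Real.log ρ⌋₊ = i
  · rw [if_pos hm, Finset.sum_filter]
    refine Finset.sum_congr rfl fun n _ => ?_
    simp only [hm, true_and]
  · rw [if_neg hm]
    refine (Finset.sum_eq_zero fun n _ => ?_).symm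
    rw [if_neg (fun h => hm h.1)]

/-- **The hyperbolic Type-II bound (static form).**  See the module docstring. -/
theorem typeII_hyperbolic_static {x : ℕ} (hx : 1 ≤ x) {δ ε A : ℝ} (hε : 0 ≤ ε) (hδ : δ ≤ 1 / 3)
    (hw : 2 < Real.exp (Real.log x / Real.log (Real.log x)))
    (hK1 : ∀ M N : ℕ, (x : ℝ) ^ (1 / 3 - δ) ≤ M → (M : ℝ) ≤ (x : ℝ) ^ (1 / 2 : ℝ) →
      (x : ℝ) ^ (1 - δ) ≤ (M : ℝ) * N → (M : ℝ) * N ≤ x → ∀ α β : ℕ → ℝ, (∀ n, |α n| ≤ 1) →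
      (∀ n, |β n| ≤ 1) →
      (∀ n, α n ≠ 0 → ∀ p ∈ n.primeFactors, Real.exp (Real.log x / Real.log (Real.log x)) ≤ p) →
      (∀ n, β n ≠ 0 → ∀ p ∈ n.primeFactors, Real.exp (Real.log x / Real.log (Real.log x)) ≤ p) →
      ∀ h : ℤ, (h = 2 ∨ h = -2) →
      |∑ m ∈ Finset.Ioc M (2 * M), ∑ n ∈ Finset.Ioc N (2 * N),
        α m * β n * (ArithmeticFunction.liouville (Int.toNat ((m : ℤ) * n + h)) : ℝ)| ≤
        (x : ℝ) / Real.log x ^ A)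
    (hK2 : ∀ M N : ℕ, (x : ℝ) ^ (1 / 3 - δ) ≤ M → (M : ℝ) ≤ (x : ℝ) ^ (1 / 2 : ℝ) →
      (x : ℝ) ^ (1 - δ) ≤ (M : ℝ) * N → (M : ℝ) * N ≤ x → ∀ α β : ℕ → ℝ, (∀ n, |α n| ≤ 1) →
      (∀ n, |β n| ≤ 1) →
      (∀ n, α n ≠ 0 → ∀ p ∈ n.primeFactors, Real.exp (Real.log x / Real.log (Real.log x)) ≤ p) →
      (∀ n, β n ≠ 0 → ∀ p ∈ n.primeFactors, Real.exp (Real.log x / Real.log (Real.log x)) ≤ p) →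
      ∀ h : ℤ, (h = 2 ∨ h = -2) →
      (∑ d ∈ (Finset.Icc 1 ⌊(x : ℝ) ^ (1 / 2 - ε)⌋₊).filter (fun d : ℕ => Odd d),
        |(∑ m ∈ Finset.Ioc M (2 * M), ∑ n ∈ (Finset.Ioc N (2 * N)).filter
            (fun n : ℕ => (d : ℤ) ∣ (m : ℤ) * n + h),
            α m * β n * (ArithmeticFunction.liouville (Int.toNat ((m : ℤ) * n + h)) : ℝ)) -
          (Nat.totient d : ℝ)⁻¹ * ∑ m ∈ Finset.Ioc M (2 * M), ∑ n ∈ Finset.Ioc N (2 * N),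
            α m * β n * (ArithmeticFunction.liouville (Int.toNat ((m : ℤ) * n + h)) : ℝ)|) ≤
        (x : ℝ) / Real.log x ^ A)
    {ρ : ℝ} (hρ : 1 < ρ) (hρ2 : ρ ≤ 6 / 5)
    {M y V₀ : ℕ} (hMlo : ρ * ((x : ℝ) ^ (1 / 3 - δ) + 1) ≤ M)
    (hMhi : 2 * (M : ℝ) ≤ (x : ℝ) ^ (2 / 3 : ℝ)) (hyx : y ≤ x)
    {α β : ℕ → ℝ} (hα : ∀ n, |α n| ≤ 1) (hβ : ∀ n, |β n| ≤ 1)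
    (hαs : ∀ n, α n ≠ 0 → ∀ p ∈ n.primeFactors, Real.exp (Real.log x / Real.log (Real.log x)) ≤ p)
    (hβs : ∀ n, β n ≠ 0 → ∀ p ∈ n.primeFactors, Real.exp (Real.log x / Real.log (Real.log x)) ≤ p)
    {Cτ : ℝ} (hCτ : ∑ k ∈ Icc 1 y, (σ 0 k : ℝ) * (σ 0 (k + 2) : ℝ) ^ 2 ≤
      Cτ * ((y : ℝ) + 2) * Real.log ((y : ℝ) + 2) ^ (20 : ℕ)) :
    ∑ d ∈ Icc 1 ⌊(x : ℝ) ^ (1 / 2 - ε)⌋₊,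
      |∑ m ∈ Ioc M (2 * M), ∑ n ∈ Ioc V₀ (y / m),
          α m * β n * (if d ∣ m * n + 2 then (liouville (m * n + 2) : ℝ) else 0)| ≤
      ((⌊Real.log (2 * M : ℕ) / Real.log ρ⌋₊ + 1 : ℕ) : ℝ) * ((⌊Real.log y / Real.log ρ⌋₊ + 1 : ℕ) : ℝ) *
          ((1 + (1 + Real.log x) ^ 2) * ((x : ℝ) / Real.log x ^ A)) +
        Real.sqrt (4 * (ρ - 1) * y + M + 4 * ρ ^ 2 * (x : ℝ) ^ (1 - δ)) *
          Real.sqrt (Cτ * ((y : ℝ) + 2) * Real.log ((y : ℝ) + 2) ^ (20 : ℕ)) := by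
  classical
  set D : ℕ := ⌊(x : ℝ) ^ (1 / 2 - ε)⌋₊ with hDdef
  set F : ℕ → ℕ → ℕ → ℝ := fun d m n =>
    α m * β n * (if d ∣ m * n + 2 then (liouville (m * n + 2) : ℝ) else 0) with hFdef
  set R := ((Ioc M (2 * M)) ×ˢ (Icc 1 y)).filter (fun p : ℕ × ℕ => p.2 ∈ Ioc V₀ (y / p.1)) with hRdef
  set cls : ℕ → ℕ := fun t => ⌊Real.log (t : ℝ) / Real.log ρ⌋₊ with hcls
  set good : ℕ × ℕ → Prop := fun q => ρ ^ (q.1 + q.2 + 2) ≤ (y : ℝ) ∧ (V₀ : ℝ) < ρ ^ q.2 ∧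
    4 * (x : ℝ) ^ (1 - δ) ≤ ρ ^ (q.1 + q.2) with hgood
  set IC := (range (cls (2 * M) + 1)) ×ˢ (range (cls y + 1)) with hIC
  set clsS : ℕ → ℕ → ℕ → ℝ := fun d i c =>
    ∑ m ∈ (Ioc M (2 * M)).filter (fun m : ℕ => cls m = i),
      ∑ n ∈ (Ioc V₀ (y / m)).filter (fun n : ℕ => cls n = c), F d m n with hclsS
  set Bnd : ℝ := (1 + (1 + Real.log x) ^ 2) * ((x : ℝ) / Real.log x ^ A) with hBnd
  -- region facts
  have hRmem : ∀ p ∈ R, 1 ≤ p.1 ∧ 1 ≤ p.2 ∧ p.1 * p.2 ≤ y := by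
    intro p hp
    simp only [hRdef, Finset.mem_filter, Finset.mem_product, Finset.mem_Ioc, Finset.mem_Icc] at hp
    obtain ⟨⟨⟨hm, -⟩, hn1, -⟩, -, hny⟩ := hp
    refine ⟨by omega, hn1, ?_⟩
    have := (Nat.le_div_iff_mul_le (by omega)).1 hny
    rw [mul_comm]; exact this
  have hmaps : ∀ p ∈ R.filter (fun p => good (cls p.1, cls p.2)),
      (cls p.1, cls p.2) ∈ IC.filter good := by
    intro p hp
    rw [Finset.mem_filter] at hp
    obtain ⟨hpR, hg⟩ := hp
    have hpR' := hpR
    simp only [hRdef, Finset.mem_filter, Finset.mem_product, Finset.mem_Ioc, Finset.mem_Icc] at hpR'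
    rw [Finset.mem_filter, hIC, Finset.mem_product, Finset.mem_range, Finset.mem_range,
      Nat.lt_succ_iff, Nat.lt_succ_iff]
    exact ⟨⟨floor_log_div_mono hρ hpR'.1.1.2, floor_log_div_mono hρ hpR'.1.2.2⟩, hg⟩
  -- per `d`: split into good classes and bad pairs
  have hperd : ∀ d : ℕ,
      |∑ m ∈ Ioc M (2 * M), ∑ n ∈ Ioc V₀ (y / m), F d m n| ≤
      ∑ q ∈ IC.filter good, |clsS d q.1 q.2| +
        ∑ p ∈ R.filter (fun p => ¬ good (cls p.1, cls p.2)), |F d p.1 p.2| := by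
    intro d
    rw [sum_region_eq_sum_pairs M y V₀ (F d), ← hRdef,
      ← Finset.sum_filter_add_sum_filter_not R (fun p => good (cls p.1, cls p.2))]
    refine (abs_add_le _ _).trans (add_le_add ?_ (Finset.abs_sum_le_sum_abs _ _))
    rw [← Finset.sum_fiberwise_of_maps_to hmaps]
    refine (Finset.abs_sum_le_sum_abs _ _).trans (Finset.sum_le_sum fun q hq => le_of_eq ?_)
    rw [Finset.mem_filter] at hq
    congr 1
    -- the fibre of `q` is the class `q`
    rw [hclsS]; simp only
    rw [class_sum_eq_sum_pairs, ← hRdef, Finset.filter_filter]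
    refine Finset.sum_congr ?_ fun _ _ => rfl
    ext p
    simp only [Finset.mem_filter]
    constructor
    · rintro ⟨hpR, -, hpq⟩
      exact ⟨hpR, (Prod.mk.inj hpq).1, (Prod.mk.inj hpq).2⟩
    · rintro ⟨hpR, h1, h2⟩
      have hpq : (cls p.1, cls p.2) = q := by
        simp only [hcls]; rw [h1, h2]
      exact ⟨hpR, by rw [hpq]; exact hq.2, hpq⟩
  -- good classes: the brick (or zero if the class misses `(M, 2M]`)
  have hgoodcls : ∀ q ∈ IC.filter good, ∑ d ∈ Icc 1 D, |clsS d q.1 q.2| ≤ Bnd := by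
    intro q hq
    rw [Finset.mem_filter] at hq
    obtain ⟨-, hg1, hg2, hg3⟩ := hq
    by_cases hne : ∃ m₀ ∈ Ioc M (2 * M), cls m₀ = q.1
    · obtain ⟨m₀, hm₀, hm₀i⟩ := hne
      have := good_class_level_sum_le_wide hx hε hδ hw hK1 hK2 hρ hρ2 hMlo hMhi hm₀ hm₀i hg3 hg1 hyx hg2
        hα hβ hαs hβs
      simpa only [hclsS, hFdef] using this
    · -- empty class
      have h0 : ∀ d, clsS d q.1 q.2 = 0 := by
        intro d
        simp only [hclsS]
        refine Finset.sum_eq_zero fun m hm => ?_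
        rw [Finset.mem_filter] at hm
        exact absurd ⟨m, hm.1, hm.2⟩ hne
      simp only [h0, abs_zero, Finset.sum_const_zero]
      rw [hBnd]
      have : 0 ≤ (x : ℝ) / Real.log x ^ A := by
        rcases le_or_gt 0 (Real.log x ^ A) with h | h
        · exact div_nonneg (Nat.cast_nonneg x) h
        · -- `log x ≥ 0` so the power is nonnegative; this branch is vacuous
          exact absurd h (not_lt.mpr (Real.rpow_nonneg (Real.log_nonneg (by exact_mod_cast hx)) A))
      positivity
  -- bad pairs
  have hbad : ∑ d ∈ Icc 1 D, ∑ p ∈ R.filter (fun p => ¬ good (cls p.1, cls p.2)), |F d p.1 p.2| ≤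
      Real.sqrt (4 * (ρ - 1) * y + M + 4 * ρ ^ 2 * (x : ℝ) ^ (1 - δ)) *
        Real.sqrt (Cτ * ((y : ℝ) + 2) * Real.log ((y : ℝ) + 2) ^ (20 : ℕ)) := by
    have h1 := sum_level_pairs_trivial_le (R.filter (fun p => ¬ good (cls p.1, cls p.2))) y D
      (fun p hp => hRmem p (Finset.mem_filter.mp hp).1) hα hβ
    simp only [hFdef] at h1 ⊢
    refine h1.trans (mul_le_mul (Real.sqrt_le_sqrt ?_) (Real.sqrt_le_sqrt hCτ) (Real.sqrt_nonneg _)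
      (Real.sqrt_nonneg _))
    have := card_badPairs_le hρ hρ2 x M y V₀ δ
    simpa only [hRdef, hcls, hgood] using this
  -- assemble
  calc ∑ d ∈ Icc 1 D, |∑ m ∈ Ioc M (2 * M), ∑ n ∈ Ioc V₀ (y / m), F d m n|
      ≤ ∑ d ∈ Icc 1 D, (∑ q ∈ IC.filter good, |clsS d q.1 q.2| +
          ∑ p ∈ R.filter (fun p => ¬ good (cls p.1, cls p.2)), |F d p.1 p.2|) :=
        Finset.sum_le_sum fun d _ => hperd d
    _ = ∑ q ∈ IC.filter good, ∑ d ∈ Icc 1 D, |clsS d q.1 q.2| +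
          ∑ d ∈ Icc 1 D, ∑ p ∈ R.filter (fun p => ¬ good (cls p.1, cls p.2)), |F d p.1 p.2| := by
        rw [Finset.sum_add_distrib, Finset.sum_comm]
    _ ≤ ∑ q ∈ IC.filter good, Bnd +
          Real.sqrt (4 * (ρ - 1) * y + M + 4 * ρ ^ 2 * (x : ℝ) ^ (1 - δ)) *
            Real.sqrt (Cτ * ((y : ℝ) + 2) * Real.log ((y : ℝ) + 2) ^ (20 : ℕ)) :=
        add_le_add (Finset.sum_le_sum hgoodcls) hbad
    _ ≤ _ := by
        rw [Finset.sum_const, nsmul_eq_mul]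
        have hBnd0 : 0 ≤ Bnd := by
          rw [hBnd]
          have : 0 ≤ (x : ℝ) / Real.log x ^ A :=
            div_nonneg (Nat.cast_nonneg x) (Real.rpow_nonneg (Real.log_nonneg (by exact_mod_cast hx)) A)
          positivity
        have h1 : #(IC.filter good) ≤ #IC := Finset.card_filter_le _ _
        have h2 : #IC = (cls (2 * M) + 1) * (cls y + 1) := by
          rw [hIC, Finset.card_product, Finset.card_range, Finset.card_range]
        have hcard : (#(IC.filter good) : ℝ) ≤
            ((⌊Real.log (2 * M : ℕ) / Real.log ρ⌋₊ + 1 : ℕ) : ℝ) * ((⌊Real.log y / Real.log ρ⌋₊ + 1 : ℕ) : ℝ) := by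
          have : (#(IC.filter good) : ℝ) ≤ ((cls (2 * M) + 1) * (cls y + 1) : ℕ) := by
            exact_mod_cast h1.trans h2.le
          simpa only [hcls, Nat.cast_mul] using this
        exact add_le_add (mul_le_mul_of_nonneg_right hcard hBnd0) le_rfl

end Summit.Parity.GeneralizedHardyLittlewood.Theorems
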